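import Mathlib

/-!
# Route `SymPencil` — Lemma TwoRows machinery: generic element for quadratic functions, the CLAW and the
# PERFECT MATCHING in `K⁴ × K⁴` (`--supports` stmt-ValiantsHypothesis-5674 `SdcSuperquadratic`; leaf R2 of the
# `(11, 5, 4)` cascade `Cruxes/SdcSuperquadratic/Lines/sing_five_classification.lean`, memo
# `SING-FIVE-CLASSIFICATION.md` §1 (I4); rung currency only)

Abstract linear algebra behind Lemma TwoRows (memo (I4)): for a subspace `U ⊆ K⁴ × K⁴` (pairs of live rows
`(α, β)`) and the six forms `x_{ij}(α, β) = α_i β_j + α_j β_i`: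

* `exists_forall_quad_ne_zero` — GENERIC ELEMENT for finitely many functions that are quadratic along lines
  (`f (y + t y') = f y + t B + t² f y'`): if none vanishes identically on a subspace, some element is a common
  non-zero (roots of the restrictions to a line are finite; the field is infinite);
* `linear_eq_zero_of_mul_eq_zero` — `φ · ψ ≡ 0` on a subspace with `φ ≢ 0` forces `ψ ≡ 0`;
* `claw` — `dim U ≥ 5` and `x_{ij} ≡ 0` for all `j ≠ i` force `α_i ≡ β_i ≡ 0` (if `ℓ_i = (α_i, β_i)` has rank `2`
  its kernel in `U` is trivial, `dim U ≤ 2`; if rank `1`, `ℓ_i ∝ (a₀, b₀)` and the functionals `a₀ β_j + b₀ α_j`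
  (`j ≠ i`), `a₀ β_i − b₀ α_i` vanish, `dim U ≤ 4`);
* `finrank_add_finrank_le_of_dotProduct_eq_zero` — dot-orthogonal subspaces of `Kⁿ` have `dim A + dim B ≤ n`
  (`v ↦ ⟨v, ·⟩` is injective into the dual and sends `A` into the annihilator of `B`);
* `finrank_le_four_of_matching` — `x_{kk'} ≡ x_{ll'} ≡ 0` (`{k,k',l,l'} = Fin 4`) forces `dim U ≤ 4`: `U` is totally
  isotropic for the split pairing `Φ(y) · Ψ(y')` (`Φ` the four `α`'s, `Ψ` the matched `β`'s), so
  `Ψ(U ∩ ker Φ) ⊥ Φ(U)` with `Ψ` injective on `U ∩ ker Φ`.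

Consumer: `SymPencilPerFourTwoRowsCommonZeroColumn` (Lemma TwoRows and leaf R2 `stub_twoZeroRows`).  Honest framing:
[folklore] linear algebra; one leaf of ONE of four open size-27 cells; `27 ≤ sdc(per₄) ≤ 29` unchanged; the crux
`SdcSuperquadratic` and `VP ≠ VNP` untouched; no summit statement is proved here.  No definitions, no named facts.
-/

noncomputable section

set_option linter.dupNamespace false

namespace Summit.ValiantsHypothesis.ValiantsHypothesis.Theorems.SymPencilPerFourTwoRowsClawMatching

open Module Matrix

variable {K : Type*} [Field K]

/-! ## 1. Generic element for finitely many quadratic functions -/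

/-- **Generic element, quadratic version.**  Over an infinite field, if finitely many functions
`f i`, each QUADRATIC ALONG LINES (`f (y + t y') = f y + t B + t² f y'`), are each not identically
zero on a subspace `P`, some element of `P` is a common non-zero. [folklore] -/
theorem exists_forall_quad_ne_zero [Infinite K] {M : Type*} [AddCommGroup M] [Module K M]
    (P : Submodule K M) {ι : Type*} (T : Finset ι) (f : ι → M → K)
    (hf : ∀ i (y y' : M), ∃ B : K, ∀ t : K, f i (y + t • y') = f i y + t * B + t ^ 2 * f i y')
    (hT : ∀ i ∈ T, ∃ x ∈ P, f i x ≠ 0) : ∃ z ∈ P, ∀ i ∈ T, f i z ≠ 0 := by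
  classical
  induction T using Finset.induction_on with
  | empty => exact ⟨0, P.zero_mem, fun i hi => absurd hi (Finset.notMem_empty i)⟩
  | @insert a T haT ih =>
    obtain ⟨z, hz, hzT⟩ := ih fun i hi => hT i (Finset.mem_insert_of_mem hi)
    obtain ⟨w, hw, hwa⟩ := hT a (Finset.mem_insert_self a T)
    choose B hB using fun i => hf i z w
    -- the restriction of `f i` to the line `z + t w` is the polynomial `q i`
    let q : ι → Polynomial K := fun i =>
      Polynomial.C (f i z) + Polynomial.C (B i) * Polynomial.X + Polynomial.C (f i w) * Polynomial.X ^ 2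
    have hq : ∀ i t, (q i).eval t = f i (z + t • w) := fun i t => by
      simp only [q, Polynomial.eval_add, Polynomial.eval_mul, Polynomial.eval_C, Polynomial.eval_X,
        Polynomial.eval_pow, hB i t]
      ring
    have hq0 : ∀ i ∈ insert a T, q i ≠ 0 := by
      intro i hi h0
      rcases Finset.mem_insert.1 hi with rfl | hi'
      · have h2 : (q i).coeff 2 = f i w := by
          simp only [q, Polynomial.coeff_add, Polynomial.coeff_C_mul, Polynomial.coeff_X_pow,
            Polynomial.coeff_C, Polynomial.coeff_X]
          simp
        rw [h0, Polynomial.coeff_zero] at h2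
        exact hwa h2.symm
      · have := hq i 0
        rw [h0, Polynomial.eval_zero, zero_smul, add_zero] at this
        exact hzT i hi' this.symm
    let bad : Finset K := (insert a T).biUnion fun i => (q i).roots.toFinset
    obtain ⟨t, ht⟩ := Infinite.exists_notMem_finset bad
    refine ⟨z + t • w, P.add_mem hz (P.smul_mem t hw), fun i hi h0 => ht ?_⟩
    refine Finset.mem_biUnion.2 ⟨i, hi, ?_⟩
    rw [Multiset.mem_toFinset, Polynomial.mem_roots (hq0 i hi), Polynomial.IsRoot.def, hq i t]
    exact h0

/-- A product of two linear functionals vanishing on a subspace has a factor vanishing there: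
if `φ y · ψ y = 0` on `P` and `φ` does not vanish on `P`, then `ψ` vanishes on `P`. [folklore] -/
theorem linear_eq_zero_of_mul_eq_zero {M : Type*} [AddCommGroup M] [Module K M] (P : Submodule K M)
    (φ ψ : M →ₗ[K] K) (h : ∀ y ∈ P, φ y * ψ y = 0) {y₀ : M} (hy₀ : y₀ ∈ P) (h0 : φ y₀ ≠ 0) :
    ∀ y ∈ P, ψ y = 0 := by
  intro y hy
  by_contra hne
  have hφy : φ y = 0 := by
    rcases mul_eq_zero.1 (h y hy) with h1 | h1
    · exact h1
    · exact absurd h1 hne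
  have hψ0 : ψ y₀ = 0 := by
    rcases mul_eq_zero.1 (h y₀ hy₀) with h1 | h1
    · exact absurd h1 h0
    · exact h1
  have hsum := h (y₀ + y) (P.add_mem hy₀ hy)
  rw [map_add, map_add, hφy, hψ0, add_zero, zero_add] at hsum
  rcases mul_eq_zero.1 hsum with h1 | h1
  · exact h0 h1
  · exact hne h1

/-! ## 2. The claw: `x_{ij} ≡ 0` for all `j ≠ i` forces the column `i` to vanish -/

/-- **Claw.**  Let `U ⊆ K⁴ × K⁴` have dimension `≥ 5` and suppose that for a fixed index `i` the
three forms `x_{ij}(α, β) = α_i β_j + α_j β_i` (`j ≠ i`) vanish on `U`.  Then `α_i = β_i = 0` on `U`.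
(If `ℓ_i = (α_i, β_i)` has rank `2` on `U` its kernel in `U` is `0`, so `dim U ≤ 2`; if it has rank `1`,
`ℓ_i = φ · (a₀, b₀)` and the four forms `a₀ β_j + b₀ α_j` (`j ≠ i`), `a₀ β_i − b₀ α_i` vanish, so
`dim U ≤ 4`.) [folklore] -/
theorem claw (U : Submodule K ((Fin 4 → K) × (Fin 4 → K))) (h5 : 5 ≤ finrank K U) (i : Fin 4)
    (h : ∀ y ∈ U, ∀ j, j ≠ i → y.1 i * y.2 j + y.1 j * y.2 i = 0) :
    ∀ y ∈ U, y.1 i = 0 ∧ y.2 i = 0 := by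
  by_contra hc
  push Not at hc
  obtain ⟨y₀, hy₀, hne⟩ := hc
  -- polarised identity
  have hpol : ∀ y ∈ U, ∀ y' ∈ U, ∀ j, j ≠ i →
      y.1 i * y'.2 j + y'.1 i * y.2 j + y.1 j * y'.2 i + y'.1 j * y.2 i = 0 := by
    intro y hy y' hy' j hj
    have h1 := h (y + y') (U.add_mem hy hy') j hj
    simp only [Prod.fst_add, Prod.snd_add, Pi.add_apply] at h1
    linear_combination h1 - h y hy j hj - h y' hy' j hj
  have hdim : finrank K U ≤ 4 := by
    by_cases hA : ∃ y₁ ∈ U, ∃ y₂ ∈ U, y₁.1 i * y₂.2 i - y₂.1 i * y₁.2 i ≠ 0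
    · -- rank 2: the kernel of `ℓ_i` in `U` is trivial
      obtain ⟨y₁, hy₁, y₂, hy₂, hdet⟩ := hA
      let L : ((Fin 4 → K) × (Fin 4 → K)) →ₗ[K] K × K :=
        ((LinearMap.proj i).comp (LinearMap.fst K _ _)).prod ((LinearMap.proj i).comp (LinearMap.snd K _ _))
      have hinj : Function.Injective (L.comp U.subtype) := by
        rw [← LinearMap.ker_eq_bot, LinearMap.ker_eq_bot']
        rintro ⟨y', hy'⟩ hL
        have ha : y'.1 i = 0 := by simpa [L] using congrArg Prod.fst hL
        have hb : y'.2 i = 0 := by simpa [L] using congrArg Prod.snd hL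
        have hzero : ∀ j, y'.1 j = 0 ∧ y'.2 j = 0 := by
          intro j
          by_cases hj : j = i
          · rw [hj]; exact ⟨ha, hb⟩
          have e1 := hpol y₁ hy₁ y' hy' j hj
          have e2 := hpol y₂ hy₂ y' hy' j hj
          rw [ha, hb] at e1 e2
          have hX : (y₁.1 i * y₂.2 i - y₂.1 i * y₁.2 i) * y'.2 j = 0 := by
            linear_combination y₂.2 i * e1 - y₁.2 i * e2
          have hY : (y₁.1 i * y₂.2 i - y₂.1 i * y₁.2 i) * y'.1 j = 0 := by
            linear_combination (-(y₂.1 i)) * e1 + y₁.1 i * e2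
          exact ⟨(mul_eq_zero.1 hY).resolve_left hdet, (mul_eq_zero.1 hX).resolve_left hdet⟩
        apply Subtype.ext
        ext j
        · exact (hzero j).1
        · exact (hzero j).2
      have := LinearMap.finrank_le_finrank_of_injective hinj
      simp at this
      omega
    · -- rank ≤ 1: `ℓ_i ∝ (a₀, b₀)` on `U`
      push Not at hA
      set a₀ := y₀.1 i
      set b₀ := y₀.2 i
      have hprop : ∀ y ∈ U, a₀ * y.2 i = y.1 i * b₀ := fun y hy => by
        have := hA y₀ hy₀ y hy
        linear_combination this
      -- the functionals `ψ_j = a₀ β_j + b₀ α_j` vanish on `U` for `j ≠ i`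
      have hψ : ∀ j, j ≠ i → ∀ y ∈ U, a₀ * y.2 j + b₀ * y.1 j = 0 := by
        intro j hj
        let ψ : ((Fin 4 → K) × (Fin 4 → K)) →ₗ[K] K :=
          a₀ • (LinearMap.proj j).comp (LinearMap.snd K _ _) + b₀ • (LinearMap.proj j).comp (LinearMap.fst K _ _)
        have hψa : ∀ y : (Fin 4 → K) × (Fin 4 → K), ψ y = a₀ * y.2 j + b₀ * y.1 j := fun y => by
          simp [ψ]
        let φ₁ : ((Fin 4 → K) × (Fin 4 → K)) →ₗ[K] K := (LinearMap.proj i).comp (LinearMap.fst K _ _)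
        let φ₂ : ((Fin 4 → K) × (Fin 4 → K)) →ₗ[K] K := (LinearMap.proj i).comp (LinearMap.snd K _ _)
        have h1 : ∀ y ∈ U, φ₁ y * ψ y = 0 := fun y hy => by
          rw [hψa]
          have e := h y hy j hj
          have p := hprop y hy
          simp only [φ₁, LinearMap.coe_comp, Function.comp_apply, LinearMap.fst_apply, LinearMap.coe_proj,
            Function.eval]
          linear_combination a₀ * e - y.1 j * p
        have h2 : ∀ y ∈ U, φ₂ y * ψ y = 0 := fun y hy => by
          rw [hψa]
          have e := h y hy j hj
          have p := hprop y hy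
          simp only [φ₂, LinearMap.coe_comp, Function.comp_apply, LinearMap.snd_apply, LinearMap.coe_proj,
            Function.eval]
          linear_combination b₀ * e + y.2 j * p
        intro y hy
        rw [← hψa]
        by_cases ha₀ : a₀ = 0
        · have hb₀ : b₀ ≠ 0 := fun hb => hne ha₀ hb
          exact linear_eq_zero_of_mul_eq_zero U φ₂ ψ h2 hy₀ (by simpa [φ₂] using hb₀) y hy
        · exact linear_eq_zero_of_mul_eq_zero U φ₁ ψ h1 hy₀ (by simpa [φ₁] using ha₀) y hy
      by_cases ha₀ : a₀ = 0
      · have hb₀ : b₀ ≠ 0 := fun hb => hne ha₀ hb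
        -- the first row vanishes on `U`; the second row is injective
        have hfst : ∀ y ∈ U, y.1 = 0 := by
          intro y hy
          funext j
          by_cases hj : j = i
          · subst hj
            have p := hprop y hy
            rw [ha₀, zero_mul] at p
            exact (mul_eq_zero.1 p.symm).resolve_right hb₀
          · have e := hψ j hj y hy
            rw [ha₀, zero_mul, zero_add] at e
            exact (mul_eq_zero.1 e).resolve_left hb₀
        have hinj : Function.Injective ((LinearMap.snd K (Fin 4 → K) (Fin 4 → K)).comp U.subtype) := by
          rw [← LinearMap.ker_eq_bot, LinearMap.ker_eq_bot']
          rintro ⟨y, hy⟩ hL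
          apply Subtype.ext
          exact Prod.ext (hfst y hy) (by simpa using hL)
        have := LinearMap.finrank_le_finrank_of_injective hinj
        simpa using this
      · -- the first row is injective on `U`
        have hinj : Function.Injective ((LinearMap.fst K (Fin 4 → K) (Fin 4 → K)).comp U.subtype) := by
          rw [← LinearMap.ker_eq_bot, LinearMap.ker_eq_bot']
          rintro ⟨y, hy⟩ hL
          have h1 : y.1 = 0 := by simpa using hL
          apply Subtype.ext
          refine Prod.ext h1 ?_
          funext j
          by_cases hj : j = i
          · subst hj
            have p := hprop y hy
            rw [h1, Pi.zero_apply, zero_mul] at p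
            exact (mul_eq_zero.1 p).resolve_left ha₀
          · have e := hψ j hj y hy
            rw [h1, Pi.zero_apply, mul_zero, add_zero] at e
            exact (mul_eq_zero.1 e).resolve_left ha₀
        have := LinearMap.finrank_le_finrank_of_injective hinj
        simpa using this
  omega

/-! ## 3. The perfect matching: `x_{kk'} ≡ 0 ≡ x_{ll'}` is impossible in dimension `≥ 5` -/

/-- Orthogonal subspaces for the dot product on `Kⁿ` have complementary dimensions at most. [folklore] -/
theorem finrank_add_finrank_le_of_dotProduct_eq_zero {n : ℕ} (A B : Submodule K (Fin n → K))
    (h : ∀ a ∈ A, ∀ b ∈ B, a ⬝ᵥ b = 0) : finrank K A + finrank K B ≤ n := by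
  -- `v ↦ ⟨v, ·⟩` is injective into the dual, and sends `A` into the annihilator of `B`
  let D : (Fin n → K) →ₗ[K] Module.Dual K (Fin n → K) :=
    LinearMap.mk₂ K (fun v w => v ⬝ᵥ w) (fun _ _ _ => add_dotProduct _ _ _) (fun _ _ _ => smul_dotProduct _ _ _)
      (fun _ _ _ => dotProduct_add _ _ _) (fun _ _ _ => dotProduct_smul _ _ _)
  have hD : ∀ v w, D v w = v ⬝ᵥ w := fun v w => rfl
  have hDinj : Function.Injective D := by
    rw [← LinearMap.ker_eq_bot, LinearMap.ker_eq_bot']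
    intro v hv
    funext j
    have := congrArg (fun φ : Module.Dual K (Fin n → K) => φ (Pi.single j 1)) hv
    simpa [hD] using this
  have hle : A.map D ≤ B.dualAnnihilator := by
    rintro _ ⟨a, ha, rfl⟩
    rw [Submodule.mem_dualAnnihilator]
    intro b hb
    rw [hD]; exact h a ha b hb
  have h1 : finrank K (A.map D) = finrank K A :=
    LinearEquiv.finrank_eq (Submodule.equivMapOfInjective D hDinj A).symm
  have h2 := Subspace.finrank_add_finrank_dualAnnihilator_eq B
  have h3 := Submodule.finrank_mono hle
  have h4 : finrank K (Fin n → K) = n := by simp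
  omega

/-- **Perfect matching.**  If `U ⊆ K⁴ × K⁴` and the two forms `α_k β_{k'} + α_{k'} β_k`, `α_l β_{l'} + α_{l'} β_l`
(`{k, k', l, l'} = Fin 4`) vanish on `U`, then `dim U ≤ 4`: `U` is totally isotropic for the split
non-degenerate pairing `Φ(y) · Ψ(y')` (`Φ` = the four `α`'s, `Ψ` = the four `β`'s permuted by the
matching), so `Ψ(ker Φ|_U) ⊥ Φ(U)` with `Ψ` injective on `ker Φ|_U`. [folklore] -/
theorem finrank_le_four_of_matching (U : Submodule K ((Fin 4 → K) × (Fin 4 → K))) (k k' l l' : Fin 4)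
    (hcov : ∀ j : Fin 4, j = k ∨ j = k' ∨ j = l ∨ j = l')
    (h1 : ∀ y ∈ U, y.1 k * y.2 k' + y.1 k' * y.2 k = 0) (h2 : ∀ y ∈ U, y.1 l * y.2 l' + y.1 l' * y.2 l = 0) :
    finrank K U ≤ 4 := by
  -- the two halves of the pairing
  let Φ : ((Fin 4 → K) × (Fin 4 → K)) →ₗ[K] (Fin 4 → K) :=
    LinearMap.pi fun t : Fin 4 => (LinearMap.proj (![k, k', l, l'] t)).comp (LinearMap.fst K _ _)
  let Ψ : ((Fin 4 → K) × (Fin 4 → K)) →ₗ[K] (Fin 4 → K) :=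
    LinearMap.pi fun t : Fin 4 => (LinearMap.proj (![k', k, l', l] t)).comp (LinearMap.snd K _ _)
  have hΦ : ∀ y, Φ y = ![y.1 k, y.1 k', y.1 l, y.1 l'] := fun y => by
    ext t; fin_cases t <;> simp [Φ]
  have hΨ : ∀ y, Ψ y = ![y.2 k', y.2 k, y.2 l', y.2 l] := fun y => by
    ext t; fin_cases t <;> simp [Ψ]
  -- isotropy (polarisation of `h1 + h2`)
  have hiso : ∀ y ∈ U, ∀ y' ∈ U, Φ y ⬝ᵥ Ψ y' = -(Φ y' ⬝ᵥ Ψ y) := by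
    intro y hy y' hy'
    have e1 := h1 (y + y') (U.add_mem hy hy')
    have e2 := h2 (y + y') (U.add_mem hy hy')
    simp only [Prod.fst_add, Prod.snd_add, Pi.add_apply] at e1 e2
    rw [hΦ, hΨ, hΦ, hΨ]
    simp only [dotProduct, Fin.sum_univ_four, Matrix.cons_val_zero, Matrix.cons_val_one, Matrix.cons_val]
    linear_combination e1 + e2 - h1 y hy - h2 y hy - h1 y' hy' - h2 y' hy'
  -- `Φ` restricted to `U`, its kernel `N` (pushed back into the ambient space), and `Ψ` on `N`
  let ΦU : U →ₗ[K] (Fin 4 → K) := Φ.comp U.subtype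
  let N : Submodule K ((Fin 4 → K) × (Fin 4 → K)) := (LinearMap.ker ΦU).map U.subtype
  have hNmem : ∀ y, y ∈ N → y ∈ U ∧ Φ y = 0 := by
    rintro _ ⟨⟨y, hyU⟩, hyN, rfl⟩
    exact ⟨hyU, LinearMap.mem_ker.1 hyN⟩
  let ΨN : N →ₗ[K] (Fin 4 → K) := Ψ.comp N.subtype
  have hΨN : LinearMap.ker ΨN = ⊥ := by
    refine LinearMap.ker_eq_bot'.2 ?_
    rintro ⟨y, hyN⟩ hΨ0
    obtain ⟨hyU, hΦ0⟩ := hNmem y hyN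
    have hΨ0' : Ψ y = 0 := hΨ0
    rw [hΦ] at hΦ0
    rw [hΨ] at hΨ0'
    have a0 : y.1 k = 0 := by have := congrFun hΦ0 0; simpa using this
    have a1 : y.1 k' = 0 := by have := congrFun hΦ0 1; simpa using this
    have a2 : y.1 l = 0 := by have := congrFun hΦ0 2; simpa using this
    have a3 : y.1 l' = 0 := by have := congrFun hΦ0 3; simpa using this
    have b0 : y.2 k' = 0 := by have := congrFun hΨ0' 0; simpa using this
    have b1 : y.2 k = 0 := by have := congrFun hΨ0' 1; simpa using this
    have b2 : y.2 l' = 0 := by have := congrFun hΨ0' 2; simpa using this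
    have b3 : y.2 l = 0 := by have := congrFun hΨ0' 3; simpa using this
    have hy1 : y.1 = 0 := by
      funext j
      rcases hcov j with h | h | h | h <;> rw [h] <;> assumption
    have hy2 : y.2 = 0 := by
      funext j
      rcases hcov j with h | h | h | h <;> rw [h] <;> assumption
    exact Subtype.ext (Prod.ext hy1 hy2)
  -- `Ψ(N) ⊥ Φ(U)`
  have horth : ∀ a ∈ LinearMap.range ΨN, ∀ b ∈ LinearMap.range ΦU, a ⬝ᵥ b = 0 := by
    rintro _ ⟨⟨y', hy'N⟩, rfl⟩ _ ⟨⟨y, hyU⟩, rfl⟩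
    obtain ⟨hy'U, hΦ0⟩ := hNmem y' hy'N
    have e := hiso y hyU y' hy'U
    rw [hΦ0, zero_dotProduct, neg_zero] at e
    show Ψ y' ⬝ᵥ Φ y = 0
    rw [dotProduct_comm]; exact e
  have hdim := finrank_add_finrank_le_of_dotProduct_eq_zero _ _ horth
  have hN : finrank K (LinearMap.range ΨN) + finrank K (LinearMap.ker ΨN) = finrank K N :=
    LinearMap.finrank_range_add_finrank_ker ΨN
  rw [hΨN, finrank_bot, add_zero] at hN
  have hN' : finrank K N = finrank K (LinearMap.ker ΦU) := Submodule.finrank_map_subtype_eq U _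
  have hrk := LinearMap.finrank_range_add_finrank_ker ΦU
  omega

end Summit.ValiantsHypothesis.ValiantsHypothesis.Theorems.SymPencilPerFourTwoRowsClawMatching

end
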